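import Literature.NumberTheory.ModularForms.PoincareSeriesWeightTwoHecke
import Mathlib.Analysis.SpecialFunctions.Pow.Continuity
import HarnessLib

/-!
# Two limit lemmas for Hecke's trick at weight 2: invariance survives the limit `s → 0⁺`, and
# `Γ(s+1)(4πm)^{−(s+1)} → (4πm)⁻¹`

Topic `Literature/NumberTheory/ModularForms` (namespace `Literature.NumberTheory.ModularForms.PoincareWeightTwo`,
continuing `PoincareSeriesWeightTwoHecke.lean`). THEOREMS ONLY. Elementary filter algebra used by the
assembly stub T7 (`stub_poincareAssembly`) of the I1 fact skeleton
`Summits/Parity/GeneralizedHardyLittlewood/Cruxes/PeterssonBoundPrinted/Lines/poincare_hecke.lean`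
(Kowalski–Michel 2000 / Iwaniec–Kowalski §14.1–§14.2, Petersson's formula at weight 2 by Hecke's trick):

* `weightTwo_invariance_of_tendsto` — if `P(γz, s) = (cz+d)² |cz+d|^{2s} P(z, s)` for all `s > 0` and
  `P(w, s) → Q(w)` as `s → 0⁺` for every `w`, then `Q(γz) = (cz+d)² Q(z)`: the weight-`(2,s)`
  automorphy of the Hecke-regularised Poincaré series (`poincareHecke_smul`) passes to the pointwise
  Hecke limit (`|cz+d|^{2s} → 1`).
* `tendsto_Gamma_div_rpow` — `Γ(s+1)/(4πm)^{s+1} → 1/(4πm)` as `s → 0⁺` (indeed as `s → 0`): the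
  constant of the unfolding identity `⟨yˢP_m(·,s), f⟩ = Γ(s+1)(4πm)^{−s−1} a_f(m)` (Iwaniec–Kowalski
  Lemma 14.3 at `k = 2` with Hecke's factor) tends to the weight-2 value `(4πm)⁻¹`.

## References

* [IwaniecKowalski2004] H. Iwaniec, E. Kowalski, *Analytic Number Theory*, §14.1 (14.4), Lemma 14.3,
  §3.2 (Hecke's trick).
-/

noncomputable section

open scoped Real Topology MatrixGroups
open Filter Complex
open UpperHalfPlane hiding I

namespace Literature.NumberTheory.ModularForms.PoincareWeightTwo

/-- **Weight-2 invariance survives Hecke's limit.** Let `P : ℍ → ℝ → ℂ` satisfy the weight-`(2,s)` law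
`P(γz, s) = J² ‖J‖^{2s} P(z, s)` for all `s > 0` (`J = cz + d`, `J ≠ 0`), and let `P(w, s) → Q(w)` as
`s → 0⁺` for `w = z` and `w = γz`. Then `Q(γz) = J² Q(z)`. [cite: IwaniecKowalski2004, §14.1 (14.4) with §3.2 (Hecke's trick)] -/
theorem weightTwo_invariance_of_tendsto {P : ℍ → ℝ → ℂ} {Q : ℍ → ℂ} {J : ℂ} (hJ : J ≠ 0) {z w : ℍ}
    (hlaw : ∀ s : ℝ, 0 < s → P w s = J ^ 2 * ((‖J‖ ^ (2 * s) : ℝ) : ℂ) * P z s)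
    (hz : Tendsto (fun s : ℝ ↦ P z s) (𝓝[>] 0) (𝓝 (Q z)))
    (hw : Tendsto (fun s : ℝ ↦ P w s) (𝓝[>] 0) (𝓝 (Q w))) :
    Q w = J ^ 2 * Q z := by
  -- `‖J‖^{2s} → 1` as `s → 0`
  have hpow : Tendsto (fun s : ℝ ↦ (((‖J‖ ^ (2 * s) : ℝ)) : ℂ)) (𝓝[>] 0) (𝓝 1) := by
    have hc : Continuous fun s : ℝ ↦ (((‖J‖ ^ (2 * s) : ℝ)) : ℂ) :=
      Complex.continuous_ofReal.comp
        ((Real.continuous_const_rpow (norm_ne_zero_iff.mpr hJ)).comp (continuous_const.mul continuous_id))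
    have h0 : (((‖J‖ ^ (2 * (0 : ℝ)) : ℝ)) : ℂ) = 1 := by simp
    rw [← h0]
    exact (hc.tendsto 0).mono_left nhdsWithin_le_nhds
  have hrhs : Tendsto (fun s : ℝ ↦ J ^ 2 * ((‖J‖ ^ (2 * s) : ℝ) : ℂ) * P z s) (𝓝[>] 0)
      (𝓝 (J ^ 2 * 1 * Q z)) := (tendsto_const_nhds.mul hpow).mul hz
  rw [mul_one] at hrhs
  have hw' : Tendsto (fun s : ℝ ↦ P w s) (𝓝[>] 0) (𝓝 (J ^ 2 * Q z)) := by
    refine hrhs.congr' ?_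
    filter_upwards [self_mem_nhdsWithin] with s hs
    exact (hlaw s hs).symm
  exact tendsto_nhds_unique hw hw'

/-- The version for the Hecke-regularised Poincaré series of `Γ₀(N)`: if `P_m(·,s) → Q` pointwise as
`s → 0⁺` and `P_m(γz,s) = (cz+d)²|cz+d|^{2s}P_m(z,s)` for `s > 0`, then `Q(γz) = (cz+d)² Q(z)` for
`γ ∈ Γ₀(N)`. [cite: IwaniecKowalski2004, §14.1 (14.4) with §3.2 (Hecke's trick)] -/
theorem poincareLimit_smul {N m : ℕ} {Q : ℍ → ℂ} (γ : SL(2, ℤ))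
    (hlaw : ∀ (s : ℝ), 0 < s → ∀ z : ℍ, poincareHecke N m s (γ • z) =
      (rowDenom ((γ : Matrix (Fin 2) (Fin 2) ℤ) 1) z) ^ 2 *
        ((‖rowDenom ((γ : Matrix (Fin 2) (Fin 2) ℤ) 1) z‖ ^ (2 * s) : ℝ) : ℂ) * poincareHecke N m s z)
    (hlim : ∀ z : ℍ, Tendsto (fun s : ℝ ↦ poincareHecke N m s z) (𝓝[>] 0) (𝓝 (Q z))) (z : ℍ) :
    Q (γ • z) = (rowDenom ((γ : Matrix (Fin 2) (Fin 2) ℤ) 1) z) ^ 2 * Q z := by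
  have hJ : rowDenom ((γ : Matrix (Fin 2) (Fin 2) ℤ) 1) z ≠ 0 := by
    refine rowDenom_ne_zero _ ?_ z
    refine ⟨-(γ 0 1), γ 0 0, ?_⟩
    have := γ.det_coe
    rw [Matrix.det_fin_two] at this
    linear_combination this
  exact weightTwo_invariance_of_tendsto (P := fun w s ↦ poincareHecke N m s w) hJ
    (fun s hs ↦ hlaw s hs z) (hlim z) (hlim (γ • z))

/-- **`Γ(s+1)/(4πm)^{s+1} → (4πm)⁻¹` as `s → 0⁺`** (`m ≥ 1`): the constant of the unfolding identity at
weight `(2,s)` tends to the weight-2 value. [cite: IwaniecKowalski2004, Lemma 14.3 (k = 2 with Hecke's factor)] -/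
theorem tendsto_Gamma_div_rpow {m : ℕ} (hm : 1 ≤ m) :
    Tendsto (fun s : ℝ ↦ Real.Gamma (s + 1) / (4 * π * m) ^ (s + 1)) (𝓝[>] 0)
      (𝓝 (1 / (4 * π * m))) := by
  have hm0 : (0 : ℝ) < 4 * π * m := by
    have : (0 : ℝ) < m := by exact_mod_cast hm
    positivity
  have hcont : ContinuousAt (fun s : ℝ ↦ Real.Gamma (s + 1) / (4 * π * m) ^ (s + 1)) 0 := by
    refine ContinuousAt.div ?_ ?_ ?_
    · exact (Real.differentiableAt_Gamma (fun n ↦ by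
        have hn : (0 : ℝ) ≤ n := Nat.cast_nonneg n
        intro h
        have : (0 : ℝ) + 1 = -(n : ℝ) := h
        linarith)).continuousAt.comp (continuousAt_id.add continuousAt_const)
    · exact ((Real.continuous_const_rpow hm0.ne').continuousAt).comp
        (continuousAt_id.add continuousAt_const)
    · exact (Real.rpow_pos_of_pos hm0 _).ne'
  have h0 : Real.Gamma ((0 : ℝ) + 1) / (4 * π * m) ^ ((0 : ℝ) + 1) = 1 / (4 * π * m) := by
    rw [zero_add, Real.Gamma_one, Real.rpow_one]
  rw [← h0]
  exact hcont.tendsto.mono_left nhdsWithin_le_nhds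

end Literature.NumberTheory.ModularForms.PoincareWeightTwo

end
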